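import Mathlib.Tactic

/-!
# The pinned LP-F point: window sign, n-form, type-defect matrices (pub-hsemireg, W2 seat w2-t1-1, gen 25)

Kernel transcription of the elementary algebra behind the record memo
`widen/W2/w2t11/lpf/g25/LAMBDA-w2t11g25.md` (THEOREM (F′-Λ), THEOREM (F′-K), COROLLARY (F′-LP), REMARK §4b)
and of `lpf/LPF-w2t11g24.md` §3 (THEOREM (F′-S) and its corollary).  LINEAGE SIDE (not formalised): on a
mixed diagonal cell `(τ, j, w)` of the one-type universe, with class invariants `A`, `y`, `N(Δ) = (A² − 9y²)/4`,
live window `A/4 + 3y²/(4A) < w ≤ A/3`, `E := 3 (w − A/3)² − N(Δ)/3`, `L := 2 (A E + N(Δ) w)`, the LP-F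
feasible set has `S′ = E/L` (F′-S), feeder type-defects `A_x = λ (E_j − E_x)` with `λ = A S′/(N(Δ) w)` (F′-Λ),
and (C2) matrix `(2/3) S′ H̄_{a_P} + (E/(2 N(Δ) w)) H̄_τ` (F′-K); `n := −E/(N(Δ) w)` is the n-law weight.
WHAT IS CHECKED HERE (ordered field for signs, field for the n-form, `ℤ`-matrices for the tables):
* `E_twelve`: `E = (4 (3w − A)² − (A² − 9y²)) / 12`;
* `window_E_neg`: on the closed window (`A > 0`, `9y² < A²`, `A² + 3y² ≤ 4 A w`, `3 w ≤ A`) one has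
  `4 (3w − A)² < A² − 9y²`, i.e. `E < 0` — so `n > 0`, the τ-coefficient shift `E/(2 N(Δ) w) = −n/2` of (ISO)
  is a DISCOUNT, and `S′ = n/(2(A n − 1)) > 0 ⟺ A n > 1` (the MIXED cells, `A n = det_SC`);
* `nform_S`, `nform_lambda`, `nform_shift`, `nform_twothirds`: with `E = −n N(Δ) w`: `E/L = n/(2(A n − 1))`,
  `A (E/L)/(N(Δ) w) = A n/(2 (A n − 1) N(Δ) w)`, `E/(2 N(Δ) w) = −n/2`, `(2/3) S′ = n/(3 (A n − 1))`;
  `Sprime_pos_iff`: for `n > 0`, `0 < n/(2(A n − 1)) ↔ 1 < A n`; `window_E_neg'`: `E < 0` in the memo's normalisation;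
* `Emat_sum`, `Emat_det`, `Emat_diff_table`, `pk_table_minus_three`: the type matrices
  `E_1 = [[−1,−1],[−1,0]]`, `E_2 = [[0,1],[1,1]]`, `E_3 = [[1,0],[0,−1]]` satisfy `E_1 + E_2 + E_3 = 0`,
  `det E_p = −1`, `E_j − E_x = [[π, π+κ],[π+κ, κ]]` with the memo's `(π, κ)` table, and `π κ − (π+κ)² = −3`
  on it; so the type-defect `Σ_p α_p E_p` sees `α` only modulo `(1,1,1)` (`typeDefect_shift`) and
  `det A_x = det (λ (E_j − E_x)) = −3 λ²` (`typeDefect_det`).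
RECORD ONLY; W2 counts 0 ∕ 0 ∕ 0 unchanged; LP-F-OPEN rows NAMED, NOT DECIDED.  Honest framing: identities and
signs of the lineage's own formulas; nothing here says HC / HC_CM / HC_AV is proved.
-/

namespace Summit.Ventures.HSemireg.PinnedPointAlgebra

section window

variable {F : Type*} [Field F] [LinearOrder F] [IsStrictOrderedRing F]

/-- `E = 3 (w − A/3)² − N(Δ)/3` with `N(Δ) = (A² − 9y²)/4`, over twelve. -/
theorem E_twelve (A y w : F) :
    3 * (w - A / 3) ^ 2 - ((A ^ 2 - 9 * y ^ 2) / 4) / 3 = (4 * (3 * w - A) ^ 2 - (A ^ 2 - 9 * y ^ 2)) / 12 := by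
  ring

/-- `E < 0` on the (closed) live window: `A > 0`, `9 y² < A²` (i.e. `N(Δ) > 0`), `A² + 3 y² ≤ 4 A w`
(i.e. `A/4 + 3y²/(4A) ≤ w`) and `3 w ≤ A` imply `4 (3 w − A)² < A² − 9 y²`. -/
theorem window_E_neg (A y w : F) (hA : 0 < A) (hy : 9 * y ^ 2 < A ^ 2)
    (hlo : A ^ 2 + 3 * y ^ 2 ≤ 4 * A * w) (hhi : 3 * w ≤ A) :
    4 * (3 * w - A) ^ 2 < A ^ 2 - 9 * y ^ 2 := by
  have hu : 0 ≤ A - 3 * w := by linarith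
  have h3 : 4 * A * (A - 3 * w) ≤ A ^ 2 - 9 * y ^ 2 := by nlinarith
  have h4 : 0 ≤ 4 * A * (A - 3 * w) := by positivity
  have h5 : (4 * A * (A - 3 * w)) * (4 * A * (A - 3 * w)) ≤ (A ^ 2 - 9 * y ^ 2) * (A ^ 2 - 9 * y ^ 2) :=
    mul_self_le_mul_self h4 h3
  have hD : 0 < A ^ 2 - 9 * y ^ 2 := by linarith
  have h6 : (A ^ 2 - 9 * y ^ 2) * (A ^ 2 - 9 * y ^ 2) < (4 * A ^ 2) * (A ^ 2 - 9 * y ^ 2) := by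
    have : A ^ 2 - 9 * y ^ 2 < 4 * A ^ 2 := by nlinarith [sq_nonneg y]
    exact mul_lt_mul_of_pos_right this hD
  have hA2 : 0 < A ^ 2 := by positivity
  nlinarith [h5, h6, hA2, mul_pos hA2 hA2]

/-- Consequently `E < 0` in the memo's normalisation. -/
theorem window_E_neg' (A y w : F) (hA : 0 < A) (hy : 9 * y ^ 2 < A ^ 2)
    (hlo : A ^ 2 + 3 * y ^ 2 ≤ 4 * A * w) (hhi : 3 * w ≤ A) :
    3 * (w - A / 3) ^ 2 - ((A ^ 2 - 9 * y ^ 2) / 4) / 3 < 0 := by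
  rw [E_twelve]
  have := window_E_neg A y w hA hy hlo hhi
  have h12 : (0 : F) < 12 := by norm_num
  rw [div_neg_iff]
  right; constructor <;> linarith

/-- For `n > 0`: `S′ = n / (2 (A n − 1)) > 0 ↔ A n > 1` (OPEN ⟺ MIXED, `A n = det_SC`). -/
theorem Sprime_pos_iff (A n : F) (hn : 0 < n) : 0 < n / (2 * (A * n - 1)) ↔ 1 < A * n := by
  rw [div_pos_iff]
  constructor
  · rintro (⟨-, h⟩ | ⟨h, -⟩)
    · linarith
    · linarith
  · intro h; left; exact ⟨hn, by linarith⟩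

end window

section nform

variable {F : Type*} [Field F] [CharZero F]

/-- n-form of the pinned `S′`: with `E = −n N(Δ) w` and `L = 2 (A E + N(Δ) w)`, `E / L = n / (2 (A n − 1))`. -/
theorem nform_S (A ND w n : F) (hND : ND ≠ 0) (hw : w ≠ 0) (hAn : A * n - 1 ≠ 0) :
    (-(n * ND * w)) / (2 * (A * (-(n * ND * w)) + ND * w)) = n / (2 * (A * n - 1)) := by
  have hL : 2 * (A * (-(n * ND * w)) + ND * w) = -(2 * (A * n - 1) * (ND * w)) := by ring
  rw [hL, div_eq_div_iff]
  · ring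
  · exact neg_ne_zero.mpr (mul_ne_zero (mul_ne_zero two_ne_zero hAn) (mul_ne_zero hND hw))
  · exact mul_ne_zero two_ne_zero hAn

/-- n-form of `λ = A S′/(N(Δ) w)`: `A (E/L) / (N(Δ) w) = A n / (2 (A n − 1) N(Δ) w)`. -/
theorem nform_lambda (A ND w n : F) (hND : ND ≠ 0) (hw : w ≠ 0) (hAn : A * n - 1 ≠ 0) :
    A * ((-(n * ND * w)) / (2 * (A * (-(n * ND * w)) + ND * w))) / (ND * w)
      = A * n / (2 * (A * n - 1) * ND * w) := by
  rw [nform_S A ND w n hND hw hAn]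
  have h2 : (2 : F) * (A * n - 1) ≠ 0 := mul_ne_zero two_ne_zero hAn
  rw [← mul_div_assoc, div_div, div_eq_div_iff]
  · ring
  · exact mul_ne_zero h2 (mul_ne_zero hND hw)
  · have : (2 : F) * (A * n - 1) * ND * w = (2 * (A * n - 1)) * (ND * w) := by ring
    rw [this]; exact mul_ne_zero h2 (mul_ne_zero hND hw)

/-- The τ-coefficient shift of (ISO): `E / (2 N(Δ) w) = −n/2`. -/
theorem nform_shift (ND w n : F) (hND : ND ≠ 0) (hw : w ≠ 0) :
    (-(n * ND * w)) / (2 * ND * w) = -n / 2 := by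
  rw [div_eq_div_iff]
  · ring
  · exact mul_ne_zero (mul_ne_zero two_ne_zero hND) hw
  · exact two_ne_zero

/-- The same-conic coefficient shift of (ISO) in n-form: `(2/3) S′ = n / (3 (A n − 1))`. -/
theorem nform_twothirds (A n : F) (hAn : A * n - 1 ≠ 0) :
    (2 / 3 : F) * (n / (2 * (A * n - 1))) = n / (3 * (A * n - 1)) := by
  have h2 : (2 : F) * (A * n - 1) ≠ 0 := mul_ne_zero two_ne_zero hAn
  have h3 : (3 : F) * (A * n - 1) ≠ 0 := mul_ne_zero three_ne_zero hAn
  rw [div_mul_div_comm, div_eq_div_iff]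
  · ring
  · exact mul_ne_zero three_ne_zero h2
  · exact h3

end nform

section typematrices

variable {R : Type*} [CommRing R]

/-- The type matrices of the lineage's GTL rows (LPF §1): `E_1 + E_2 + E_3 = 0`. -/
theorem Emat_sum :
    (!![-1, -1; -1, 0] : Matrix (Fin 2) (Fin 2) R) + !![0, 1; 1, 1] + !![1, 0; 0, -1] = 0 := by
  ext i j; fin_cases i <;> fin_cases j <;> simp

/-- `det E_p = −1` (`p = 1, 2, 3`). -/
theorem Emat_det :
    (!![-1, -1; -1, 0] : Matrix (Fin 2) (Fin 2) R).det = -1 ∧ (!![0, 1; 1, 1] : Matrix (Fin 2) (Fin 2) R).det = -1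
      ∧ (!![1, 0; 0, -1] : Matrix (Fin 2) (Fin 2) R).det = -1 := by
  refine ⟨?_, ?_, ?_⟩ <;> simp [Matrix.det_fin_two]

/-- The six differences `E_j − E_x` (`j ≠ x`) are `[[π, π+κ],[π+κ, κ]]` with `(π, κ)_(j,x)` =
`(1,2):(−1,−1) · (1,3):(−2,1) · (2,1):(1,1) · (2,3):(−1,2) · (3,1):(2,−1) · (3,2):(1,−2)` (THEOREM (F′-Λ)'s table). -/
theorem Emat_diff_table :
    (!![-1, -1; -1, 0] : Matrix (Fin 2) (Fin 2) ℤ) - !![0, 1; 1, 1] = !![-1, -2; -2, -1]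
      ∧ (!![-1, -1; -1, 0] : Matrix (Fin 2) (Fin 2) ℤ) - !![1, 0; 0, -1] = !![-2, -1; -1, 1]
      ∧ (!![0, 1; 1, 1] : Matrix (Fin 2) (Fin 2) ℤ) - !![-1, -1; -1, 0] = !![1, 2; 2, 1]
      ∧ (!![0, 1; 1, 1] : Matrix (Fin 2) (Fin 2) ℤ) - !![1, 0; 0, -1] = !![-1, 1; 1, 2]
      ∧ (!![1, 0; 0, -1] : Matrix (Fin 2) (Fin 2) ℤ) - !![-1, -1; -1, 0] = !![2, 1; 1, -1]
      ∧ (!![1, 0; 0, -1] : Matrix (Fin 2) (Fin 2) ℤ) - !![0, 1; 1, 1] = !![1, -1; -1, -2] := by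
  refine ⟨?_, ?_, ?_, ?_, ?_, ?_⟩ <;> (ext i j; fin_cases i <;> fin_cases j <;> simp)

/-- On that table `π κ − (π + κ)² = −3` — so `det (E_j − E_x) = −3` for all `j ≠ x`. -/
theorem pk_table_minus_three :
    ∀ pk ∈ [((-1 : ℤ), (-1 : ℤ)), (-2, 1), (1, 1), (-1, 2), (2, -1), (1, -2)],
      pk.1 * pk.2 - (pk.1 + pk.2) ^ 2 = -3 := by
  decide

/-- The type-defect `Σ_p α_p E_p` sees `α` only modulo `(1,1,1)` (because `E_1 + E_2 + E_3 = 0`). -/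
theorem typeDefect_shift (E₁ E₂ E₃ : Matrix (Fin 2) (Fin 2) R) (hs : E₁ + E₂ + E₃ = 0) (a b c t : R) :
    (a + t) • E₁ + (b + t) • E₂ + (c + t) • E₃ = a • E₁ + b • E₂ + c • E₃ := by
  have ht : t • E₁ + t • E₂ + t • E₃ = 0 := by rw [← smul_add, ← smul_add, hs, smul_zero]
  simp only [add_smul]
  rw [show a • E₁ + t • E₁ + (b • E₂ + t • E₂) + (c • E₃ + t • E₃)
      = (a • E₁ + b • E₂ + c • E₃) + (t • E₁ + t • E₂ + t • E₃) by abel, ht, add_zero]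

/-- THEOREM (F′-Λ)'s type-defect `A_x = λ (E_j − E_x) = λ [[π, π+κ],[π+κ, κ]]` has
`det A_x = λ² (π κ − (π+κ)²)` — i.e. `−3 λ²` on the table: a non-degenerate indefinite form. -/
theorem typeDefect_det (lam π κ : R) :
    (lam • (!![π, π + κ; π + κ, κ] : Matrix (Fin 2) (Fin 2) R)).det = lam ^ 2 * (π * κ - (π + κ) ^ 2) := by
  rw [Matrix.det_smul, Matrix.det_fin_two, Fintype.card_fin]
  simp
  ring

end typematrices

end Summit.Ventures.HSemireg.PinnedPointAlgebra
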